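import Summits.HubbardSuperconductivity.HubbardSuperconductivity.Theorems.KLProgrammeKLRegimeTwoPointAssemblyMatsubaraPartitionAllU
import Literature.MathematicalPhysics.QuantumLattice.HubbardThermalTwoPointMatsubaraLimit
import HarnessLib

/-!
# Route `KLProgramme`, crux K3, child 4 `KLRegimeTwoPointAssembly` — stub `stub_asm_partition` (ALL `U`)

Cell gate-hubbard-kl, seat t2.  The child-4 skeleton (`asm-repr`, lead hubbard-kl-r2d-p2, registered on
stmt-HubbardSuperconductivity-19637) asks, besides the Matsubara identification `stub_asm_matsubara` (supplied by
`…Theorems.MatsubaraAllU.tendsto_grassmannTwoPoint_eq_hubbardThermalTwoPoint_sub_allU`), that the bare normalised Grassmann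
partition function be EVENTUALLY NON-ZERO in the cutoff `M`, for every coupling.  This is immediate from the all-coupling
partition bridge `tendsto_effPartitionFn_hubbard_eq_partitionFn_div_allU`: the limit
`e^{−βUL²/4} Z_L(β; U, μ+U/2)/Z_L(β; 0, μ)` is non-zero (positive partition functions).

* **`stub_asm_partition`** — verbatim the registered stub signature.
-/

namespace Summit.HubbardSuperconductivity.HubbardSuperconductivity.Theorems.TwoPointAssembly

set_option linter.dupNamespace false -- summit = problem name (single-conjunct summit), D-0017

open Filter Topology Literature.MathematicalPhysics.QuantumLattice Literature.Probability.LatticeModels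
open Literature.MathematicalPhysics.QuantumLattice.GrassmannAlgebra
open scoped ComplexOrder

/-- **`stub_asm_partition`** (ALL `U`): for `L ≥ 3`, `β > 0` and every real `μ, U`, the bare normalised Grassmann partition
function `∫dμ_{C_M} e^{−V_M(U)}` is eventually (in `M`) non-zero — it converges to
`e^{-βUL²/4} Z(U, μ+U/2)/Z(0, μ) ≠ 0` by `MatsubaraAllU.tendsto_effPartitionFn_hubbard_eq_partitionFn_div_allU`. -/
theorem stub_asm_partition : ∀ (L : ℕ) [NeZero L], 3 ≤ L → ∀ (β : ℝ), 0 < β → ∀ (μ U : ℝ),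
    ∀ᶠ M : ℕ in atTop, effPartitionFn ℂ (hubbardCovariance L M β μ 0) (hubbardInteraction L M β U) ≠ 0 := by
  intro L _ hL β hβ μ U
  haveI : Nonempty (Finset (Orb (FermionTorus 2 L))) := ⟨∅⟩
  have hZ' : Matrix.partitionFn β (hubbardTorusWith 2 L 1 U (μ + U / 2)) ≠ 0 :=
    (Matrix.partitionFn_pos β (isHermitian_hamiltonianWith (fermionTorusGraph 2 L) 1 U (μ + U / 2))).ne'
  have hZ₀ : Matrix.partitionFn β (hubbardTorusWith 2 L 1 0 μ) ≠ 0 :=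
    (Matrix.partitionFn_pos β (isHermitian_hamiltonianWith (fermionTorusGraph 2 L) 1 0 μ)).ne'
  have he : ((Real.exp (-(β * U / 4 * (L : ℝ) ^ 2)) : ℝ) : ℂ) ≠ 0 := by exact_mod_cast (Real.exp_pos _).ne'
  have hden : ((Real.exp (-(β * U / 4 * (L : ℝ) ^ 2)) : ℝ) : ℂ) *
      Matrix.partitionFn β (hubbardTorusWith 2 L 1 U (μ + U / 2)) /
      Matrix.partitionFn β (hubbardTorusWith 2 L 1 0 μ) ≠ 0 :=
    div_ne_zero (mul_ne_zero he hZ') hZ₀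
  exact (MatsubaraAllU.tendsto_effPartitionFn_hubbard_eq_partitionFn_div_allU hL hβ μ U).eventually_ne hden

end Summit.HubbardSuperconductivity.HubbardSuperconductivity.Theorems.TwoPointAssembly
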